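import Mathlib
import HarnessLib
import Literature.Barriers.ValiantsHypothesis.PartialDerivativesDetPerm
import Literature.Computability.AlgebraicComplexity.StandardFamiliesProofs
import Summits.ValiantsHypothesis.ValiantsHypothesis.Theorems.SummationBitsHomogeneousRung

/-!
# Route SummationBits — crux `Depth3Thesis` (stmt-ValiantsHypothesis-5934), stub `stub_flattening`

**Claim settled.** The Nisan–Wigderson flattening count for AFFINE depth-three (ΣΠΣ) expressions of
the permanent, uniformly in the order `k` and in the product degree `D`: if
`per_n = Σ_{i<r} Π_{j<D} ℓ_ij` over `ℂ` with every `ℓ_ij` of total degree `≤ 1`, then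
`binom(n,k)² ≤ r · binom(D,k)`.

## Proof (method of partial derivatives)

* Case `k ≤ D`. Every `k`-th order iterated partial of a product `Π_{j<D} ℓ_j` of `D` affine forms
  lies in the span of the `binom(D, D-k)` sub-products `Π_{j ∈ T} ℓ_j`, `#T = D - k` (a factor
  differentiated twice dies; `Summit.ValiantsHypothesis.SummationBits.iterPDeriv_prod_mem_span`,
  tree, any finite index type). Derivatives are additive (`iterPDeriv_sum`, tree), so the `k`-th
  order partials of `Σ_{i<r} Π_{j<D} ℓ_ij` span at most `r · binom(D,k)` dimensions
  (`finrank_range_le_card`), while those of `per_n` span exactly `binom(n,k)²` dimensions (tree,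
  PROVED: `Literature.Barriers.ValiantsHypothesis.flatteningRank_perPoly`, all `n, k`).
* Case `D < k`, `n < k`: `binom(n,k) = 0`.
* Case `D < k ≤ n`: impossible, since `deg (Σ Π ℓ) ≤ D < n = deg per_n`
  (`Literature.Computability.AlgebraicComplexity.totalDegree_perPoly_holds`, tree).

This generalises the proved support item `HomogeneousRung` (`D = n`, `k = ⌊n/2⌋`,
`Theorems/SummationBitsHomogeneousRung.lean`), whose proof is adapted here.

## References

* [NisanWigderson1996] N. Nisan, A. Wigderson, *Lower bounds on arithmetic circuits via partial
  derivatives*, Comput. Complexity 6 (1996/97), §3.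
* [LandsbergGCT2017] J. M. Landsberg, *Geometry and Complexity Theory*, CUP 2017, Prop. 7.2.2.1
  (p. 188) and Exercise 6.2.2.7 (p. 159).
-/

open MvPolynomial Finset

-- `Summit.ValiantsHypothesis.ValiantsHypothesis.…` is the tree's mandated single-conjunct layout.
set_option linter.dupNamespace false

namespace Summit.ValiantsHypothesis.ValiantsHypothesis.Theorems.SummationBitsDepth3Thesis

open Literature.Barriers.ValiantsHypothesis Literature.Computability.AlgebraicComplexity

/-- Degree bookkeeping: a sum of products of `D` polynomials of total degree `≤ 1` has total
degree `≤ D`. [folklore] -/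
theorem totalDegree_sum_prod_affine_le {R : Type*} [CommSemiring R] {σ : Type*} {r D : ℕ}
    (ℓ : Fin r → Fin D → MvPolynomial σ R) (hℓ : ∀ i j, (ℓ i j).totalDegree ≤ 1) :
    (∑ i, ∏ j, ℓ i j).totalDegree ≤ D := by
  refine totalDegree_finsetSum_le fun i _ => ?_
  calc (∏ j, ℓ i j).totalDegree ≤ ∑ j, (ℓ i j).totalDegree := totalDegree_finsetProd _ _
    _ ≤ ∑ _j : Fin D, 1 := Finset.sum_le_sum fun j _ => hℓ i j
    _ = D := by simp

/-- **Stub `stub_flattening`** of the line `Cruxes/Depth3Thesis/Lines/birth.lean` for crux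
`Depth3Thesis` (stmt-ValiantsHypothesis-5934): the Nisan–Wigderson flattening count for affine
ΣΠΣ expressions of the permanent, all orders `k` and all product degrees `D`. If
`per_n = Σ_{i<r} Π_{j<D} ℓ_ij` over `ℂ` with `ℓ_ij` of total degree `≤ 1`, then
`binom(n,k)² ≤ r · binom(D,k)`. [cite: NisanWigderson1996, §3]
[cite: LandsbergGCT2017, Prop. 7.2.2.1 and Exercise 6.2.2.7] -/
theorem stub_flattening :
    ∀ (n k r D : ℕ) (ℓ : Fin r → Fin D → MvPolynomial (Fin n × Fin n) ℂ),
      (∀ i j, (ℓ i j).totalDegree ≤ 1) →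
        (∑ i, ∏ j, ℓ i j) = perPoly (Fin n) ℂ → (n.choose k) ^ 2 ≤ r * D.choose k := by
  intro n k r D ℓ hℓ hsum
  classical
  rcases Nat.lt_or_ge D k with hDk | hkD
  · -- degenerate regime `D < k`
    rcases Nat.lt_or_ge n k with hnk | hkn
    · -- `binom(n,k) = 0`
      rw [Nat.choose_eq_zero_of_lt hnk]
      simp
    · -- `D < k ≤ n` contradicts `deg (Σ Π ℓ) ≤ D < n = deg per_n`
      exfalso
      have hdeg := totalDegree_sum_prod_affine_le ℓ hℓ
      rw [hsum, totalDegree_perPoly_holds (n := Fin n) (k := ℂ), Fintype.card_fin] at hdeg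
      omega
  · -- flattening regime `k ≤ D`: the `r · binom(D, D-k)` sub-products `Π_{j ∈ T} ℓ_ij`
    let b : Fin r × {T : Finset (Fin D) // T.card = D - k} → MvPolynomial (Fin n × Fin n) ℂ :=
      fun p => ∏ j ∈ p.2.1, ℓ p.1 j
    -- the `k`-th order partials of `per_n = Σ Π ℓ` lie in their span
    have hle : Submodule.span ℂ (derivSet k (perPoly (Fin n) ℂ)) ≤
        Submodule.span ℂ (Set.range b) := by
      rw [Submodule.span_le]
      rintro _ ⟨l, hl, rfl⟩
      rw [← hsum, iterPDeriv_sum]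
      refine Submodule.sum_mem _ fun i _ => ?_
      have hmem :=
        Summit.ValiantsHypothesis.SummationBits.iterPDeriv_prod_mem_span (ℓ i) (hℓ i) l
      refine Submodule.span_mono ?_ hmem
      rintro _ ⟨T, rfl⟩
      exact ⟨(i, ⟨T.1, by rw [T.2, Fintype.card_fin, hl]⟩), rfl⟩
    -- dimension count
    have hfin : Module.finrank ℂ (Submodule.span ℂ (derivSet k (perPoly (Fin n) ℂ))) =
        (n.choose k) ^ 2 := by
      rw [← shiftedPartialsRank_zero_eq ℂ k (perPoly (Fin n) ℂ), flatteningRank_perPoly ℂ n k]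
    haveI : Module.Finite ℂ (Submodule.span ℂ (Set.range b)) :=
      Module.Finite.span_of_finite ℂ (Set.finite_range b)
    have h1 : Module.finrank ℂ (Submodule.span ℂ (derivSet k (perPoly (Fin n) ℂ))) ≤
        Module.finrank ℂ (Submodule.span ℂ (Set.range b)) := Submodule.finrank_mono hle
    have h2 : Module.finrank ℂ (Submodule.span ℂ (Set.range b)) ≤
        Fintype.card (Fin r × {T : Finset (Fin D) // T.card = D - k}) := finrank_range_le_card b
    rw [Fintype.card_prod, Fintype.card_fin, Fintype.card_finset_len, Fintype.card_fin,
      Nat.choose_symm hkD] at h2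
    rw [← hfin]
    exact h1.trans h2

end Summit.ValiantsHypothesis.ValiantsHypothesis.Theorems.SummationBitsDepth3Thesis
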